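import Literature.Geometry.Kaehler.LelongNumber
import Literature.Geometry.Kaehler.HolomorphicChainSingularNull
import Literature.Geometry.GeometricMeasureTheory.RectifiableVarifold
import HarnessLib

/-!
# The Lelong number of the mass of a holomorphic chain

For a holomorphic `p`-chain `T = Σ kⱼ [Aⱼ]` on an open `Ω ⊆ V` (`p = q + 1 ≥ 1`) the tree measures
the mass of the current `[T]` in balls by `∫_{reg|T| ∩ B(a,r)} |θ_T| d𝓗^{2p}`
(`HolomorphicChainDensityBound.lean`, `HolomorphicChainBlowUpBounded.lean`: `≤ C r^{2p}`). This file
computes its Lelong number: for `a ∈ Ω`,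

  `∫_{reg|T| ∩ B(a,r)} |θ_T| d𝓗^{2p} / (c(2p) r^{2p}) ⟶ Σⱼ |kⱼ| · n(Aⱼ, a)`  as `r → 0⁺`

(`HolomorphicChain.tendsto_lintegral_enorm_density_div`), a finite sum of natural numbers — the
`2p`-density of the mass measure `‖T‖ = Σ |kⱼ| 𝓗^{2p} ⌞ Aⱼ` is the multiplicity-weighted sum of the
Lelong numbers of the components through `a` (Harvey: the multiplicity of `T` at `z` is
*"(4) the density (or Lelong number)"* [Harvey1977, §1.9]; Chirka's `n(T, a, r)`, linear in the
chain [Chirka1989, §15.1, p. 190]). The key identity is the exact mass formula on small balls,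

* `HolomorphicChain.setLIntegral_enorm_density_eq_sum` —
  `∫_{reg|T| ∩ B(b,r)} |θ_T| d𝓗^{2p} = Σ_{Z ∈ F} |k_Z| 𝓗^{2p}(Z ∩ B(b,r))` whenever `𝐁(b, r₀) ⊆ Ω`,
  `r ≤ r₀` and the finite set `F` contains every component meeting `𝐁(b, r₀)` (the tree had `≤`,
  `lintegral_enorm_density_le`): distinct components meet in `𝓗^{2p}`-null sets
  ([Chirka1989, §5.3 Cor. 1], `IsIrreducibleAnalyticSet.euclideanHausdorffMeasure_image_inter_eq_zero`),
  `sng |T|` is `𝓗^{2p}`-null ([Harvey1977, Lemma 1.6]), and off these null sets a point of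
  `Z ∩ B(b,r)` is a regular point of `|T|` lying on no other component, where `θ_T = k_Z`
  (`multAt_eq_mult`);

followed by `tendsto_lintegral_enorm_density_div` (sum of the limits
`tendsto_massRatio_lelongNumber` of the components) and `exists_nat_eq_finsum_lelongNumber` (the
limit is a natural number). Finally the closed-ball form: `tendsto_lintegral_enorm_density_closedBall_div`
(the same limit along `𝐁(a, r)`, by the squeeze `B(a,r) ⊆ 𝐁(a,r) ⊆ B(a,θr)`, `θ → 1⁺`) and
`hasDensity_massMeasure` — the `2p`-density (`HasDensity`, `RectifiableVarifold.lean`, closed balls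
after [Federer1969, 2.10.19]) of the mass measure `‖T‖ = |θ_T| · 𝓗^{2p} ⌞ reg|T|` at `a ∈ Ω` exists
and equals `Σ_Z |k_Z| n(Z, a)`.

Theorems only; no new definitions, no named facts.

## References

* E. M. Chirka, *Complex Analytic Sets*, Kluwer 1989, §5.3 Cor. 1, §15.1 (p. 190), §16.1 (p. 206)
  [Chirka1989].
* R. Harvey, *Holomorphic chains and their boundaries*, PSPUM XXX.1 (1977), §1.9, Lemma 1.6
  [Harvey1977].
-/

noncomputable section

open scoped Manifold Topology ENNReal
open Set Filter MeasureTheory Metric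

namespace Literature.Geometry.Kaehler

open Literature.Geometry.GeometricMeasureTheory

-- Nested operator-norm instances on `Covector V m`, as in `Currents.lean`.
set_option maxSynthPendingDepth 2

universe u

variable {V : Type u} [NormedAddCommGroup V] [InnerProductSpace ℂ V] [FiniteDimensional ℂ V]
  [MeasurableSpace V] [BorelSpace V] {Ω : TopologicalSpace.Opens V} {q : ℕ}

namespace HolomorphicChain

/-- `sng |T|` is `𝓗^{2(q+1)}`-null for a holomorphic `(q+1)`-chain (from the `μH[k]` statement of
`HolomorphicChainSingularNull.lean`, `k = 2q + 2 > 2q`). [cite: Harvey1977, Lemma 1.6] -/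
theorem euclideanHausdorffMeasure_two_mul_image_singularLocus_eq_zero
    (T : HolomorphicChain 𝓘(ℂ, V) Ω (q + 1)) :
    (μHE[2 * (q + 1)] : Measure V) ((↑) '' singularLocus 𝓘(ℂ, V) T.support : Set V) = 0 := by
  rw [Measure.euclideanHausdorffMeasure_def, Measure.smul_apply,
    T.hausdorffMeasure_image_singularLocus_eq_zero (by omega), smul_zero]

/-- Two distinct components of a holomorphic chain meet in an `𝓗^{2p}`-null set.
[cite: Chirka1989, §5.3 Cor. 1, p. 55] -/
theorem euclideanHausdorffMeasure_image_inter_components_eq_zero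
    (T : HolomorphicChain 𝓘(ℂ, V) Ω (q + 1)) {Z Z' : Set Ω} (hZ : T.mult Z ≠ 0)
    (hZ' : T.mult Z' ≠ 0) (hne : Z ≠ Z') :
    (μHE[2 * (q + 1)] : Measure V) ((↑) '' (Z ∩ Z') : Set V) = 0 := by
  obtain ⟨c, hpc, hZc⟩ := T.hasPureDim_of_mult_ne_zero hZ
  obtain ⟨c', hpc', hZ'c⟩ := T.hasPureDim_of_mult_ne_zero hZ'
  obtain rfl : c' = c := by omega
  exact (T.isIrreducibleAnalyticSet_of_mult_ne_zero hZ).euclideanHausdorffMeasure_image_inter_eq_zero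
    (T.isIrreducibleAnalyticSet_of_mult_ne_zero hZ') hpc hZc hZ'c hne

/-- **Exact mass of a holomorphic chain in a small ball**:
`∫_{reg|T| ∩ B(b,r)} |θ_T| d𝓗^{2p} = Σ_{Z ∈ F} |k_Z| · 𝓗^{2p}(Z ∩ B(b,r))` for `r ≤ r₀` and any
finite `F ⊇` the components meeting `𝐁(b, r₀)` (`‖Σ kⱼ [Aⱼ]‖ = Σ |kⱼ| 𝓗^{2p} ⌞ Aⱼ`).
[cite: Chirka1989, §16.1, p. 206] -/
theorem setLIntegral_enorm_density_eq_sum (T : HolomorphicChain 𝓘(ℂ, V) Ω (q + 1)) {b : V}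
    {r r₀ : ℝ} (hr : r ≤ r₀) (F : Finset (Set Ω))
    (hF : ∀ Z : Set Ω, T.mult Z ≠ 0 → (((↑) '' Z : Set V) ∩ closedBall b r₀).Nonempty → Z ∈ F) :
    ∫⁻ x in T.carrier ∩ ball b r, ‖(T.density x : ℝ)‖ₑ ∂(μHE[2 * (q + 1)] : Measure V) =
      ∑ Z ∈ F, ENNReal.ofReal |(T.mult Z : ℝ)| *
        (μHE[2 * (q + 1)] : Measure V) (((↑) '' Z : Set V) ∩ ball b r) := by
  classical
  haveI : LocallyCompactSpace Ω := Ω.isOpen.locallyCompactSpace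
  refine le_antisymm (T.lintegral_enorm_density_le T.measurableSet_carrier hr F hF) ?_
  set μ : Measure V := μHE[2 * (q + 1)] with hμ
  -- the components of `F` with nonzero multiplicity
  set F' : Finset (Set Ω) := F.filter fun Z => T.mult Z ≠ 0 with hF'
  have hF'mem : ∀ Z, Z ∈ F' ↔ Z ∈ F ∧ T.mult Z ≠ 0 := fun Z => Finset.mem_filter
  -- the null set: `sng |T|` and the pairwise intersections of the components in `F'`
  set S : Set V := (↑) '' singularLocus 𝓘(ℂ, V) T.support with hS
  set P : Set V := ⋃ Z ∈ F', ⋃ Z' ∈ F'.erase Z, ((↑) '' (Z ∩ Z') : Set V) with hP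
  have hSnull : μ S = 0 := T.euclideanHausdorffMeasure_two_mul_image_singularLocus_eq_zero
  have hPnull : μ P = 0 := by
    refine (measure_biUnion_null_iff F'.countable_toSet).2 fun Z hZ => ?_
    refine (measure_biUnion_null_iff (F'.erase Z).countable_toSet).2 fun Z' hZ' => ?_
    have hZ'F : Z' ∈ F' := Finset.mem_of_mem_erase hZ'
    exact T.euclideanHausdorffMeasure_image_inter_components_eq_zero ((hF'mem Z).1 hZ).2
      ((hF'mem Z').1 hZ'F).2 (Finset.ne_of_mem_erase hZ').symm
  have hNnull : μ (S ∪ P) = 0 := measure_union_null hSnull hPnull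
  -- measurability
  have hSc : IsClosed (singularLocus 𝓘(ℂ, V) T.support) :=
    (isAnalyticSet_singularLocus_holds 𝓘(ℂ, V) Ω T.isAnalyticSet_support).isClosed
  have hSm : MeasurableSet S := measurableSet_image_coe_of_isClosed hSc
  have hZclosed : ∀ Z ∈ F', IsClosed Z := fun Z hZ =>
    (T.isIrreducibleAnalyticSet_of_mult_ne_zero ((hF'mem Z).1 hZ).2).1.isClosed
  have hZm : ∀ Z ∈ F', MeasurableSet ((↑) '' Z : Set V) := fun Z hZ =>
    measurableSet_image_coe_of_isClosed (hZclosed Z hZ)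
  have hPm : MeasurableSet P := by
    refine Finset.measurableSet_biUnion _ fun Z hZ => Finset.measurableSet_biUnion _ fun Z' hZ' => ?_
    exact measurableSet_image_coe_of_isClosed
      ((hZclosed Z hZ).inter (hZclosed Z' (Finset.mem_of_mem_erase hZ')))
  have hNm : MeasurableSet (S ∪ P) := hSm.union hPm
  -- the good parts `G Z = (Z ∩ B(b,r)) ∖ (S ∪ P)`
  set G : Set Ω → Set V := fun Z => (((↑) '' Z : Set V) ∩ ball b r) \ (S ∪ P) with hG
  have hGm : ∀ Z ∈ F', MeasurableSet (G Z) := fun Z hZ =>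
    ((hZm Z hZ).inter measurableSet_ball).diff hNm
  -- a point of `G Z` lies on no other component of nonzero multiplicity
  have honly : ∀ Z ∈ F', ∀ y : Ω, (y : V) ∈ G Z → ∀ Z', T.mult Z' ≠ 0 → y ∈ Z' → Z' = Z := by
    intro Z hZ y hy Z' hZ' hyZ'
    by_contra hne
    have hyZ : y ∈ Z := by
      obtain ⟨y', hy', hyy'⟩ := hy.1.1
      rwa [← Subtype.ext hyy']
    have hZ'F : Z' ∈ F := hF Z' hZ' ⟨y, ⟨y, hyZ', rfl⟩, (ball_subset_closedBall.trans
      (closedBall_subset_closedBall hr)) hy.1.2⟩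
    have hZ'F' : Z' ∈ F'.erase Z := Finset.mem_erase.2 ⟨hne, (hF'mem Z').2 ⟨hZ'F, hZ'⟩⟩
    exact hy.2 (Or.inr (mem_iUnion₂.2 ⟨Z, hZ, mem_iUnion₂.2 ⟨Z', hZ'F', ⟨y, ⟨hyZ, hyZ'⟩, rfl⟩⟩⟩))
  -- on `G Z` the density is `k_Z`, and `G Z ⊆ reg|T|`
  have hdens : ∀ Z ∈ F', ∀ x ∈ G Z, ‖(T.density x : ℝ)‖ₑ = ENNReal.ofReal |(T.mult Z : ℝ)| := by
    intro Z hZ x hx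
    obtain ⟨y, hyZ, rfl⟩ := hx.1.1
    rw [Real.enorm_eq_ofReal_abs, density_apply_coe, multAt_eq_mult hyZ (honly Z hZ y hx)]
  have hGcar : ∀ Z ∈ F', G Z ⊆ T.carrier ∩ ball b r := by
    intro Z hZ x hx
    obtain ⟨y, hyZ, rfl⟩ := hx.1.1
    have hysupp : y ∈ T.support := mem_support_iff.2 ⟨Z, ((hF'mem Z).1 hZ).2, hyZ⟩
    have hyreg : y ∈ regularLocus 𝓘(ℂ, V) T.support := by
      by_contra h
      exact hx.2 (Or.inl ⟨y, ⟨hysupp, h⟩, rfl⟩)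
    exact ⟨⟨y, hyreg, rfl⟩, hx.1.2⟩
  -- the `G Z` are pairwise disjoint
  have hdisj : Set.PairwiseDisjoint (↑F' : Set (Set Ω)) G := by
    intro Z hZ Z' hZ' hne
    refine Set.disjoint_left.2 fun x hx hx' => ?_
    obtain ⟨y, hyZ, rfl⟩ := hx.1.1
    have hyZ' : y ∈ Z' := by
      obtain ⟨y', hy', hyy'⟩ := hx'.1.1
      rwa [← Subtype.ext hyy']
    exact hne (honly Z' hZ' y hx' Z ((hF'mem Z).1 hZ).2 hyZ).symm.symm
  -- assemble
  calc ∑ Z ∈ F, ENNReal.ofReal |(T.mult Z : ℝ)| * μ (((↑) '' Z : Set V) ∩ ball b r)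
      = ∑ Z ∈ F', ENNReal.ofReal |(T.mult Z : ℝ)| * μ (((↑) '' Z : Set V) ∩ ball b r) := by
        rw [hF', Finset.sum_filter]
        refine Finset.sum_congr rfl fun Z _ => ?_
        by_cases h : T.mult Z ≠ 0
        · rw [if_pos h]
        · rw [if_neg h]
          push Not at h
          simp [h]
    _ = ∑ Z ∈ F', ENNReal.ofReal |(T.mult Z : ℝ)| * μ (G Z) := by
        refine Finset.sum_congr rfl fun Z _ => ?_
        rw [hG]
        simp only
        rw [measure_sdiff_null hNnull]
    _ = ∑ Z ∈ F', ∫⁻ x in G Z, ‖(T.density x : ℝ)‖ₑ ∂μ := by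
        refine Finset.sum_congr rfl fun Z hZ => ?_
        rw [← setLIntegral_const, setLIntegral_congr_fun (hGm Z hZ) fun x hx => (hdens Z hZ x hx).symm]
    _ = ∫⁻ x in ⋃ Z ∈ F', G Z, ‖(T.density x : ℝ)‖ₑ ∂μ :=
        (lintegral_biUnion_finset hdisj (fun Z hZ => hGm Z hZ) _).symm
    _ ≤ ∫⁻ x in T.carrier ∩ ball b r, ‖(T.density x : ℝ)‖ₑ ∂μ :=
        lintegral_mono_set (iUnion₂_subset fun Z hZ => hGcar Z hZ)

/-- **The Lelong number of the mass of a holomorphic chain**: for `a ∈ Ω`,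
`∫_{reg|T| ∩ B(a,r)} |θ_T| d𝓗^{2p} / (c(2p) r^{2p}) → Σ_Z |k_Z| · n(Z, a)` as `r → 0⁺` (a finite
sum: only the components through `a` contribute). [cite: Chirka1989, §15.1, p. 190] -/
theorem tendsto_lintegral_enorm_density_div (T : HolomorphicChain 𝓘(ℂ, V) Ω (q + 1)) {a : V}
    (ha : a ∈ (Ω : Set V)) :
    Tendsto (fun r : ℝ => (∫⁻ x in T.carrier ∩ ball a r, ‖(T.density x : ℝ)‖ₑ
        ∂(μHE[2 * (q + 1)] : Measure V)) /
        (unitBallVolume (2 * (q + 1)) * ENNReal.ofReal (r ^ (2 * (q + 1))))) (𝓝[>] 0)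
      (𝓝 (∑ᶠ Z : Set Ω, ENNReal.ofReal |(T.mult Z : ℝ)| * lelongNumber Z (q + 1) a)) := by
  classical
  -- a closed ball inside `Ω` and the finitely many components meeting it
  obtain ⟨R₀, hR₀, hR₀Ω⟩ := Metric.isOpen_iff.1 Ω.isOpen a ha
  have hr₀ : 0 < R₀ / 2 := by positivity
  have hK : closedBall a (R₀ / 2) ⊆ (Ω : Set V) := (closedBall_subset_ball (by linarith)).trans hR₀Ω
  have hKc := isCompact_preimage_coe_closedBall (Ω := Ω) hK
  set F := (T.finite_inter_compact hKc).toFinset with hFdef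
  have hFmem : ∀ Z, Z ∈ F ↔ T.mult Z ≠ 0 ∧ (((↑) ⁻¹' closedBall a (R₀ / 2) : Set Ω) ∩ Z).Nonempty :=
    fun Z => Set.Finite.mem_toFinset _
  have hF : ∀ Z : Set Ω, T.mult Z ≠ 0 → (((↑) '' Z : Set V) ∩ closedBall a (R₀ / 2)).Nonempty →
      Z ∈ F := by
    rintro Z hZ ⟨_, ⟨x', hx', rfl⟩, hxK⟩
    exact (hFmem Z).2 ⟨hZ, ⟨x', hxK, hx'⟩⟩
  -- the `finsum` is the sum over `F`
  have hsum : (∑ᶠ Z : Set Ω, ENNReal.ofReal |(T.mult Z : ℝ)| * lelongNumber Z (q + 1) a) =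
      ∑ Z ∈ F, ENNReal.ofReal |(T.mult Z : ℝ)| * lelongNumber Z (q + 1) a := by
    refine finsum_eq_finsetSum_of_support_subset _ fun Z hZ => ?_
    rw [Function.mem_support] at hZ
    have hm : T.mult Z ≠ 0 := fun h => hZ (by simp [h])
    have hn : lelongNumber Z (q + 1) a ≠ 0 := fun h => hZ (by simp [h])
    have haZ : a ∈ ((↑) '' Z : Set V) := by
      by_contra h
      exact hn (lelongNumber_eq_zero (T.hasPureDim_of_mult_ne_zero hm) ha h)
    exact Finset.mem_coe.2 (hF Z hm ⟨a, haZ, mem_closedBall_self hr₀.le⟩)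
  rw [hsum]
  -- on `(0, R₀/2)` the ratio is the finite sum of the weighted mass ratios of the components
  have heq : ∀ r ∈ Ioo (0 : ℝ) (R₀ / 2),
      (∫⁻ x in T.carrier ∩ ball a r, ‖(T.density x : ℝ)‖ₑ ∂(μHE[2 * (q + 1)] : Measure V)) /
        (unitBallVolume (2 * (q + 1)) * ENNReal.ofReal (r ^ (2 * (q + 1)))) =
      ∑ Z ∈ F, ENNReal.ofReal |(T.mult Z : ℝ)| * massRatio Z (q + 1) a r := by
    intro r hr
    rw [T.setLIntegral_enorm_density_eq_sum hr.2.le F hF, div_eq_mul_inv, Finset.sum_mul]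
    refine Finset.sum_congr rfl fun Z _ => ?_
    rw [massRatio_apply, div_eq_mul_inv, mul_assoc]
  have hlim : Tendsto (fun r : ℝ => ∑ Z ∈ F, ENNReal.ofReal |(T.mult Z : ℝ)| * massRatio Z (q + 1) a r)
      (𝓝[>] 0) (𝓝 (∑ Z ∈ F, ENNReal.ofReal |(T.mult Z : ℝ)| * lelongNumber Z (q + 1) a)) := by
    refine tendsto_finsetSum F fun Z hZ => ?_
    exact ENNReal.Tendsto.const_mul
      (tendsto_massRatio_lelongNumber (T.hasPureDim_of_mult_ne_zero ((hFmem Z).1 hZ).1) ha)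
      (Or.inr ENNReal.ofReal_ne_top)
  refine hlim.congr' ?_
  filter_upwards [Ioo_mem_nhdsGT hr₀] with r hr using (heq r hr).symm

/-- **The Lelong number of the mass of a holomorphic chain is a natural number**
(`Σ_Z |k_Z| n(Z, a)` with `n(Z, a) ∈ ℕ`). [cite: Chirka1989, §15.1 Prop. 2, p. 190] -/
theorem exists_nat_eq_finsum_lelongNumber (T : HolomorphicChain 𝓘(ℂ, V) Ω (q + 1)) {a : V}
    (ha : a ∈ (Ω : Set V)) :
    ∃ n : ℕ, (∑ᶠ Z : Set Ω, ENNReal.ofReal |(T.mult Z : ℝ)| * lelongNumber Z (q + 1) a) = n := by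
  classical
  haveI : LocallyCompactSpace Ω := Ω.isOpen.locallyCompactSpace
  -- the support of the summand is finite (components through `a`)
  obtain ⟨K, hKc, hKa⟩ := exists_compact_mem_nhds (⟨a, ha⟩ : Ω)
  set F := (T.finite_inter_compact hKc).toFinset with hFdef
  have hFmem : ∀ Z, Z ∈ F ↔ T.mult Z ≠ 0 ∧ (K ∩ Z).Nonempty := fun Z => Set.Finite.mem_toFinset _
  have hsupp : (Function.support fun Z : Set Ω =>
      ENNReal.ofReal |(T.mult Z : ℝ)| * lelongNumber Z (q + 1) a) ⊆ ↑F := by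
    intro Z hZ
    rw [Function.mem_support] at hZ
    have hm : T.mult Z ≠ 0 := fun h => hZ (by simp [h])
    have hn : lelongNumber Z (q + 1) a ≠ 0 := fun h => hZ (by simp [h])
    have haZ : a ∈ ((↑) '' Z : Set V) := by
      by_contra h
      exact hn (lelongNumber_eq_zero (T.hasPureDim_of_mult_ne_zero hm) ha h)
    obtain ⟨a', ha'Z, ha'⟩ := haZ
    have : a' = ⟨a, ha⟩ := Subtype.ext ha'
    exact Finset.mem_coe.2 ((hFmem Z).2 ⟨hm, ⟨a', this ▸ mem_of_mem_nhds hKa, ha'Z⟩⟩)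
  rw [finsum_eq_finsetSum_of_support_subset _ hsupp]
  -- each term is a natural number
  have hterm : ∀ Z ∈ F, ∃ n : ℕ, ENNReal.ofReal |(T.mult Z : ℝ)| * lelongNumber Z (q + 1) a = n := by
    intro Z hZ
    obtain ⟨n, hn⟩ := exists_nat_lelongNumber_eq_of_mem (T.hasPureDim_of_mult_ne_zero ((hFmem Z).1 hZ).1) ha
    refine ⟨(T.mult Z).natAbs * n, ?_⟩
    rw [hn, Nat.cast_mul, ← ENNReal.ofReal_natCast (T.mult Z).natAbs, Nat.cast_natAbs, Int.cast_abs]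
  choose! n hn using hterm
  refine ⟨∑ Z ∈ F, n Z, ?_⟩
  rw [Nat.cast_sum]
  exact Finset.sum_congr rfl fun Z hZ => hn Z hZ

/-! ### Closed balls: the density of the mass measure `‖T‖` -/

/-- **Closed-ball form**: `∫_{reg|T| ∩ 𝐁(a,r)} |θ_T| d𝓗^{2p} / (c(2p) r^{2p}) → Σ_Z |k_Z| n(Z, a)` as
`r → 0⁺` (`B(a,r) ⊆ 𝐁(a,r) ⊆ B(a, θ r)` for `θ > 1`, and `θ → 1⁺`). [cite: Federer1969, 2.10.19] -/
theorem tendsto_lintegral_enorm_density_closedBall_div (T : HolomorphicChain 𝓘(ℂ, V) Ω (q + 1))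
    {a : V} (ha : a ∈ (Ω : Set V)) :
    Tendsto (fun r : ℝ => (∫⁻ x in T.carrier ∩ closedBall a r, ‖(T.density x : ℝ)‖ₑ
        ∂(μHE[2 * (q + 1)] : Measure V)) /
        (unitBallVolume (2 * (q + 1)) * ENNReal.ofReal (r ^ (2 * (q + 1))))) (𝓝[>] 0)
      (𝓝 (∑ᶠ Z : Set Ω, ENNReal.ofReal |(T.mult Z : ℝ)| * lelongNumber Z (q + 1) a)) := by
  set L := ∑ᶠ Z : Set Ω, ENNReal.ofReal |(T.mult Z : ℝ)| * lelongNumber Z (q + 1) a with hL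
  set I : Set V → ℝ≥0∞ := fun S => ∫⁻ x in T.carrier ∩ S, ‖(T.density x : ℝ)‖ₑ
    ∂(μHE[2 * (q + 1)] : Measure V) with hI
  set D : ℝ → ℝ≥0∞ := fun r => unitBallVolume (2 * (q + 1)) * ENNReal.ofReal (r ^ (2 * (q + 1)))
    with hD
  have hImono : ∀ S S' : Set V, S ⊆ S' → I S ≤ I S' := fun S S' h =>
    lintegral_mono_set (inter_subset_inter_right _ h)
  have hlim : Tendsto (fun r : ℝ => I (ball a r) / D r) (𝓝[>] 0) (𝓝 L) :=
    T.tendsto_lintegral_enorm_density_div ha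
  have hC0 := (unitBallVolume_ne_zero_ne_top (2 * (q + 1))).1
  have hCt := (unitBallVolume_ne_zero_ne_top (2 * (q + 1))).2
  refine tendsto_of_le_liminf_of_limsup_le ?_ ?_
  · -- `L ≤ liminf` : open balls inside closed balls
    rw [← hlim.liminf_eq]
    exact liminf_le_liminf (Eventually.of_forall fun r =>
      ENNReal.div_le_div_right (hImono _ _ ball_subset_closedBall) _)
  · -- `limsup ≤ L θ^{2p}` for every `θ > 1`
    have hθ : ∀ θ : ℝ, 1 < θ →
        limsup (fun r : ℝ => I (closedBall a r) / D r) (𝓝[>] 0) ≤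
          L * ENNReal.ofReal (θ ^ (2 * (q + 1))) := by
      intro θ hθ
      have hθ0 : 0 < θ := zero_lt_one.trans hθ
      have hscale : Tendsto (fun r : ℝ => θ * r) (𝓝[>] 0) (𝓝[>] 0) := by
        refine tendsto_nhdsWithin_of_tendsto_nhds_of_eventually_within _ ?_ ?_
        · have h : Tendsto (fun r : ℝ => θ * r) (𝓝 0) (𝓝 (θ * 0)) :=
            tendsto_const_nhds.mul tendsto_id
          rw [mul_zero] at h
          exact h.mono_left nhdsWithin_le_nhds
        · filter_upwards [self_mem_nhdsWithin] with r hr using mul_pos hθ0 hr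
      have hlim' : Tendsto (fun r : ℝ => I (ball a (θ * r)) / D (θ * r) *
          ENNReal.ofReal (θ ^ (2 * (q + 1)))) (𝓝[>] 0)
          (𝓝 (L * ENNReal.ofReal (θ ^ (2 * (q + 1))))) :=
        ENNReal.Tendsto.mul_const (hlim.comp hscale) (Or.inr ENNReal.ofReal_ne_top)
      rw [← hlim'.limsup_eq]
      refine limsup_le_limsup ?_
      filter_upwards [self_mem_nhdsWithin] with r hr
      have hr0 : (0 : ℝ) < r := hr
      have hsub : closedBall a r ⊆ ball a (θ * r) := closedBall_subset_ball (by nlinarith)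
      have hT : ENNReal.ofReal (θ ^ (2 * (q + 1))) ≠ 0 ∧ ENNReal.ofReal (θ ^ (2 * (q + 1))) ≠ ⊤ :=
        ⟨(ENNReal.ofReal_pos.2 (pow_pos hθ0 _)).ne', ENNReal.ofReal_ne_top⟩
      have hDθ : D (θ * r) = D r * ENNReal.ofReal (θ ^ (2 * (q + 1))) := by
        simp only [hD]
        rw [mul_pow, mul_comm (θ ^ (2 * (q + 1))), ENNReal.ofReal_mul (pow_nonneg hr0.le _), mul_assoc]
      calc I (closedBall a r) / D r ≤ I (ball a (θ * r)) / D r :=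
            ENNReal.div_le_div_right (hImono _ _ hsub) _
        _ = I (ball a (θ * r)) * ENNReal.ofReal (θ ^ (2 * (q + 1))) /
              (D r * ENNReal.ofReal (θ ^ (2 * (q + 1)))) :=
            (ENNReal.mul_div_mul_right _ _ hT.1 hT.2).symm
        _ = I (ball a (θ * r)) / D (θ * r) * ENNReal.ofReal (θ ^ (2 * (q + 1))) := by
            rw [← hDθ, div_eq_mul_inv, div_eq_mul_inv, mul_right_comm]
    have hcont : Tendsto (fun θ : ℝ => L * ENNReal.ofReal (θ ^ (2 * (q + 1)))) (𝓝[>] 1) (𝓝 L) := by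
      have h1 : Tendsto (fun θ : ℝ => θ ^ (2 * (q + 1))) (𝓝[>] (1 : ℝ)) (𝓝 1) := by
        have h : Tendsto (fun θ : ℝ => θ ^ (2 * (q + 1))) (𝓝[>] (1 : ℝ)) (𝓝 ((1 : ℝ) ^ (2 * (q + 1)))) :=
          ((continuous_pow (2 * (q + 1))).tendsto (1 : ℝ)).mono_left (nhdsWithin_le_nhds (s := Ioi 1))
        simpa using h
      have h2 := ENNReal.tendsto_ofReal h1
      rw [ENNReal.ofReal_one] at h2
      simpa using ENNReal.Tendsto.const_mul h2 (Or.inl one_ne_zero)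
    exact ge_of_tendsto hcont (by
      filter_upwards [self_mem_nhdsWithin] with θ hθ1 using hθ θ hθ1)

/-- **The density of the mass measure `‖T‖ = |θ_T| · 𝓗^{2p} ⌞ reg|T|` exists at every `a ∈ Ω` and
equals `Σ_Z |k_Z| n(Z, a)`** (`HasDensity` of `RectifiableVarifold.lean`, closed balls).
[cite: Federer1969, 2.10.19] -/
theorem hasDensity_massMeasure (T : HolomorphicChain 𝓘(ℂ, V) Ω (q + 1)) {a : V}
    (ha : a ∈ (Ω : Set V)) :
    HasDensity (2 * (q + 1))
      ((((μHE[2 * (q + 1)] : Measure V).restrict T.carrier).withDensity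
        fun x => ‖(T.density x : ℝ)‖ₑ)) a
      (∑ᶠ Z : Set Ω, ENNReal.ofReal |(T.mult Z : ℝ)| * lelongNumber Z (q + 1) a) := by
  have h := T.tendsto_lintegral_enorm_density_closedBall_div ha
  refine h.congr fun r => ?_
  rw [densityRatio, withDensity_apply _ measurableSet_closedBall,
    Measure.restrict_restrict measurableSet_closedBall, inter_comm]

end HolomorphicChain

end Literature.Geometry.Kaehler

end
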